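import Summits.QuantumFields.YangMills.Theorems.IR.SCFloorCubeGeometry

/-!
# Strong-coupling floor engine, part 13: no short polymer joins two NON-facing plaquettes in adjacent time slices

Pooled prover `ym-ir-line-bsf-p1` (crux `IR`, stmt-QuantumFields-19354), geometry for the OFF-DIAGONAL terms of the
slice sum `s(1) = Σ_{x⃗} Cov(P_{(0,x⃗)}, P_{(1,0⃗)})` (consumer: line `momentum-pincer` rung R2,
`NoLightMoversSCTransfer`).  On the 4-torus `(ℤ/L)⁴`, `L ≥ 3`, let `P = (a; 1,2)` and `P' = (a'; 1,2)` with
`a' 0 = a 0 + 1` (adjacent time slices) but `a' ≠ a + e₀` (NOT facing).  Then there is NO set `Q` of at most four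
plaquettes such that every bond of `P` lies in a member of `Q` other than `P` and every bond of `P'` in a member of `Q`
other than `P'` (`no_short_covering_offdiag`).  With the antisymmetric-pair peeling of part 5 this says that the Mayer
polymers of order `≤ 4` all vanish for such a pair, so the covariance is `O(β⁵)` (part 14) — one order above the
facing pair's `β⁴` law.  Ingredients: the covering map `bonds(P) → Q` is injective (`covering_step`, from part 4's
`bond_unique_of_ne`), so each of the four members of `Q` contains a bond of `P` at time `a 0` and a bond of `P'` at
time `a 0 + 1`; such a plaquette is timelike and its two bonds are time translates of each other
(`eq_shift_of_shares_succ`); hence all four bonds of `(a + e₀; 1,2)` are bonds of `P'`, forcing `P' = (a + e₀; 1,2)`.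
Pure combinatorics; nothing here bears on the Yang–Mills mass gap.
-/

set_option autoImplicit false

open Function
open Literature.MathematicalPhysics.QuantumFieldTheory

namespace Summit.QuantumFields.YangMills.Cruxes.IR.SCFloor

variable {L : ℕ}

/-- **The covering map is injective** (the `step` of part 4's `eq_laterals_of_covering`, exported).  If every bond of
`P = (x; 1,2)` lies in a member of `Q` other than `P`, then `|Q| ≥ 4`, and if moreover `|Q| ≤ 4` then every member of
`Q` is different from `P` and contains a bond of `P`. -/
theorem covering_step (hL : 3 ≤ L) {Q : Finset (Plaquette 4 L)} (hcard : Q.card ≤ 4) (x : Site 4 L)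
    (hx : ∀ e ∈ ({(x, (1 : Fin 4)), (x.shift 1, (2 : Fin 4)), (x.shift 2, (1 : Fin 4)), (x, (2 : Fin 4))} :
        Finset (Edge 4 L)),
      ∃ q ∈ Q, q ≠ (x, ⟨((1 : Fin 4), (2 : Fin 4)), by decide⟩) ∧
        e ∈ ({(q.1, q.2.1.1), (q.1.shift q.2.1.1, q.2.1.2), (q.1.shift q.2.1.2, q.2.1.1), (q.1, q.2.1.2)} :
          Finset (Edge 4 L))) :
    4 ≤ Q.card ∧ ∀ q ∈ Q, q ≠ (x, ⟨((1 : Fin 4), (2 : Fin 4)), by decide⟩) ∧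
      ∃ e ∈ ({(x, (1 : Fin 4)), (x.shift 1, (2 : Fin 4)), (x.shift 2, (1 : Fin 4)), (x, (2 : Fin 4))} :
        Finset (Edge 4 L)),
        e ∈ ({(q.1, q.2.1.1), (q.1.shift q.2.1.1, q.2.1.2), (q.1.shift q.2.1.2, q.2.1.1), (q.1, q.2.1.2)} :
          Finset (Edge 4 L)) := by
  classical
  have hne : ∀ {x : Site 4 L} {q : Plaquette 4 L},
      q ≠ (x, ⟨((1 : Fin 4), (2 : Fin 4)), by decide⟩) → ¬ (q.1 = x ∧ q.2.1.1 = 1 ∧ q.2.1.2 = 2) := by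
    rintro x ⟨y, ⟨⟨i, j⟩, hij⟩⟩ hq ⟨rfl, hi, hj⟩
    simp only at hi hj
    subst hi; subst hj
    exact hq rfl
  set B : Finset (Edge 4 L) :=
    {(x, (1 : Fin 4)), (x.shift 1, (2 : Fin 4)), (x.shift 2, (1 : Fin 4)), (x, (2 : Fin 4))} with hB
  let f : Edge 4 L → Plaquette 4 L := fun e =>
    if he : e ∈ B then Classical.choose (hx e he) else (x, ⟨((1 : Fin 4), (2 : Fin 4)), by decide⟩)
  have hf : ∀ e (he : e ∈ B), f e ∈ Q ∧ f e ≠ (x, ⟨((1 : Fin 4), (2 : Fin 4)), by decide⟩) ∧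
      e ∈ ({((f e).1, (f e).2.1.1), ((f e).1.shift (f e).2.1.1, (f e).2.1.2),
        ((f e).1.shift (f e).2.1.2, (f e).2.1.1), ((f e).1, (f e).2.1.2)} : Finset (Edge 4 L)) := by
    intro e he
    have hspec := Classical.choose_spec (hx e he)
    simp only [f, dif_pos he]
    exact ⟨hspec.1, hspec.2.1, hspec.2.2⟩
  have hinj : Set.InjOn f B := by
    intro e he e' he' hee'
    have h := hf e he
    have h' := hf e' he'
    rw [← hee'] at h'
    exact bond_unique_of_ne hL x (f e).1 (f e).2.2 (hne h.2.1) he h.2.2 he' h'.2.2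
  have hmaps : ∀ e ∈ B, f e ∈ Q := fun e he => (hf e he).1
  have hcardB : B.card = 4 := card_bondP hL x
  have h4 : 4 ≤ Q.card := by have := Finset.card_le_card_of_injOn f hmaps hinj; omega
  refine ⟨h4, fun q hq => ?_⟩
  obtain ⟨e, he, rfl⟩ := Finset.surj_on_of_inj_on_of_card_le (fun e _ => f e) hmaps
    (fun a b ha hb h => hinj ha hb h) (by omega) q hq
  exact ⟨(hf e he).2.1, e, he, (hf e he).2.2⟩

/-- **Two non-timelike bonds of one plaquette in consecutive time slices are time translates of each other.**  If the
plaquette `(y; i, j)`, `i < j`, contains bonds `e` and `e'` of directions `≠ 0` with `e'.1 0 = e.1 0 + 1`, then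
`e' = (e.1 + e₀, e.2)` (`L ≥ 3`). -/
theorem eq_shift_of_shares_succ (hL : 3 ≤ L) (y : Site 4 L) {i j : Fin 4} (hij : i < j) {e e' : Edge 4 L}
    (he2 : e.2 ≠ 0) (he'2 : e'.2 ≠ 0) (ht : e'.1 0 = e.1 0 + 1)
    (heq : e ∈ ({(y, i), (y.shift i, j), (y.shift j, i), (y, j)} : Finset (Edge 4 L)))
    (he'q : e' ∈ ({(y, i), (y.shift i, j), (y.shift j, i), (y, j)} : Finset (Edge 4 L))) :
    e' = (e.1.shift 0, e.2) := by
  have h1 : (1 : ZMod L) ≠ 0 := by haveI : Fact (1 < L) := ⟨by omega⟩; exact one_ne_zero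
  have h2 := Literature.MathematicalPhysics.QuantumLattice.zmod_one_add_one_ne_zero_of_three_le hL
  have hj0 : j ≠ 0 := fun h => by subst h; exact absurd hij (Fin.not_lt_zero _)
  have hQ := bondQ_cases y i j heq
  have hQ' := bondQ_cases y i j he'q
  obtain ⟨z, k⟩ := e
  obtain ⟨z', k'⟩ := e'
  simp only at he2 he'2 ht hQ hQ' ⊢
  by_cases hi0 : i = 0
  · subst hi0
    have h0j : (0 : Fin 4) ≠ j := fun h => hj0 h.symm
    rcases hQ with ⟨rfl, hz | hz⟩ | ⟨rfl, hz | hz⟩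
    · exact absurd rfl he2
    · exact absurd rfl he2
    · rcases hQ' with ⟨rfl, hz' | hz'⟩ | ⟨rfl, hz' | hz'⟩
      · exact absurd rfl he'2
      · exact absurd rfl he'2
      · subst hz; subst hz'; simp [shift_apply, h1] at ht
      · subst hz; subst hz'
        simp only [shift_apply, ↓reduceIte] at ht
        exact absurd (by linear_combination ht.symm) h2
    · rcases hQ' with ⟨rfl, hz' | hz'⟩ | ⟨rfl, hz' | hz'⟩
      · exact absurd rfl he'2
      · exact absurd rfl he'2
      · subst hz; subst hz'; rfl
      · subst hz; subst hz'; simp [h1] at ht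
  · -- a spatial plaquette: all its bonds sit in one time slice
    have h0i : (0 : Fin 4) ≠ i := fun h => hi0 h.symm
    have h0j : (0 : Fin 4) ≠ j := fun h => hj0 h.symm
    have hzt : z 0 = y 0 := by
      rcases hQ with ⟨-, rfl | rfl⟩ | ⟨-, rfl | rfl⟩ <;> simp [shift_apply, h0i, h0j]
    have hz't : z' 0 = y 0 := by
      rcases hQ' with ⟨-, rfl | rfl⟩ | ⟨-, rfl | rfl⟩ <;> simp [shift_apply, h0i, h0j]
    rw [hzt, hz't] at ht
    exact absurd ht (by simp [h1])

/-- **No short polymer covers two non-facing plaquettes in adjacent time slices.**  Let `P = (a; 1,2)` and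
`P' = (a'; 1,2)` on the 4-torus (`L ≥ 3`) with `a' 0 = a 0 + 1` and `a' ≠ a + e₀`.  If every bond of `P` lies in a
member of `Q` other than `P` and every bond of `P'` in a member of `Q` other than `P'`, then `|Q| ≥ 5`. -/
theorem no_short_covering_offdiag (hL : 3 ≤ L) (a a' : Site 4 L) (ha' : a' 0 = a 0 + 1) (hne : a' ≠ a.shift 0)
    {Q : Finset (Plaquette 4 L)} (hcard : Q.card ≤ 4)
    (h0 : ∀ e ∈ ({(a, (1 : Fin 4)), (a.shift 1, (2 : Fin 4)), (a.shift 2, (1 : Fin 4)), (a, (2 : Fin 4))} :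
        Finset (Edge 4 L)),
      ∃ q ∈ Q, q ≠ (a, ⟨((1 : Fin 4), (2 : Fin 4)), by decide⟩) ∧
        e ∈ ({(q.1, q.2.1.1), (q.1.shift q.2.1.1, q.2.1.2), (q.1.shift q.2.1.2, q.2.1.1), (q.1, q.2.1.2)} :
          Finset (Edge 4 L)))
    (h1 : ∀ e ∈ ({(a', (1 : Fin 4)), (a'.shift 1, (2 : Fin 4)), (a'.shift 2, (1 : Fin 4)), (a', (2 : Fin 4))} :
        Finset (Edge 4 L)),
      ∃ q ∈ Q, q ≠ (a', ⟨((1 : Fin 4), (2 : Fin 4)), by decide⟩) ∧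
        e ∈ ({(q.1, q.2.1.1), (q.1.shift q.2.1.1, q.2.1.2), (q.1.shift q.2.1.2, q.2.1.1), (q.1, q.2.1.2)} :
          Finset (Edge 4 L))) : False := by
  classical
  obtain ⟨-, hQ1⟩ := covering_step hL hcard a' h1
  -- every bond `e` of `P` has its time translate `e + e₀` among the bonds of `P'`
  have key : ∀ e ∈ ({(a, (1 : Fin 4)), (a.shift 1, (2 : Fin 4)), (a.shift 2, (1 : Fin 4)), (a, (2 : Fin 4))} :
        Finset (Edge 4 L)),
      (e.1.shift 0, e.2) ∈ ({(a', (1 : Fin 4)), (a'.shift 1, (2 : Fin 4)), (a'.shift 2, (1 : Fin 4)), (a', (2 : Fin 4))} :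
        Finset (Edge 4 L)) := by
    intro e he
    obtain ⟨q, hq, -, heq⟩ := h0 e he
    obtain ⟨-, e', he', he'q⟩ := hQ1 q hq
    obtain ⟨e0, -, hP⟩ := bondP_cases a he
    obtain ⟨e0', -, hP'⟩ := bondP_cases a' he'
    have he2 : e.2 ≠ 0 := by rcases hP with h | h <;> simp [h.1]
    have he'2 : e'.2 ≠ 0 := by rcases hP' with h | h <;> simp [h.1]
    have ht : e'.1 0 = e.1 0 + 1 := by rw [e0', e0, ha']
    obtain ⟨y, ⟨⟨i, j⟩, hij⟩⟩ := q
    have h := eq_shift_of_shares_succ hL y hij he2 he'2 ht heq he'q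
    rw [← h]; exact he'
  -- hence the bonds `(a + e₀, 1)` and `(a + e₀, 2)` of `(a + e₀; 1,2)` are both bonds of `P' ≠ (a + e₀; 1,2)`
  have hb1 : ((a.shift 0, (1 : Fin 4)) : Edge 4 L) ∈ ({(a', (1 : Fin 4)), (a'.shift 1, (2 : Fin 4)),
      (a'.shift 2, (1 : Fin 4)), (a', (2 : Fin 4))} : Finset (Edge 4 L)) := key (a, 1) (by simp)
  have hb2 : ((a.shift 0, (2 : Fin 4)) : Edge 4 L) ∈ ({(a', (1 : Fin 4)), (a'.shift 1, (2 : Fin 4)),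
      (a'.shift 2, (1 : Fin 4)), (a', (2 : Fin 4))} : Finset (Edge 4 L)) := key (a, 2) (by simp)
  have hP' : ¬ (a' = a.shift 0 ∧ (1 : Fin 4) = 1 ∧ (2 : Fin 4) = 2) := fun h => hne h.1
  have h12 := bond_unique_of_ne hL (a.shift 0) a' (show (1 : Fin 4) < 2 by decide) hP'
    (e := (a.shift 0, 1)) (e' := (a.shift 0, 2)) (by simp) (by simpa using hb1) (by simp) (by simpa using hb2)
  exact absurd (Prod.ext_iff.1 h12).2 (by simp)

end Summit.QuantumFields.YangMills.Cruxes.IR.SCFloor
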